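import Summits.PneNP.PneNP.Theorems.RamseyUncertifiableResolutionUncertaintyPinMonotoneWalk

/-!
# PIN WIDTH: short dag-like refutations of the unary clique CNF never show many pins at once — item stmt-PneNP-9816
# `RamseyUncertifiable.ResolutionUncertainty` (support)

The sharpest form of the Delayer-injection counting, valid for EVERY resolution refutation `π` of `Clique(G, k)`.
Along Delayer `Q`'s walk (`TreeLike.run π (TreeLike.answer n k Q) r ·`), the clause on the current line is falsified by
the current record, so its negative literals are pin variables of vertices of `Q` (`shown_subset`): read modulo `n`
they form a set `shown(Q, s) ⊆ Q`, the pins of `Q` SHOWN at time `s`. Call `max_s |shown(Q, s)|` the PIN WIDTH of `Q`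
in `π`.

`card_filter_pinWidth_le`: for all `t, p`, the number of `t`-cliques `Q` of pin width `≥ p` (some clause on the walk
shows at least `p` of `Q`'s pins) is at most `|π| · Σ_{e ≤ t - p} C(n, e)` — the map `Q ↦ (that line, Q ∖ shown)` is
injective. This contains the pin-loss bound of `…PinLoss.lean` (the last non-initial line is a line of the walk) and
the tree-like / pin-monotone theorems (width `t`). Reading: a refutation of length `n^{o(log n)}` of the clique formula
of a 2-Ramsey graph keeps, for almost every `Θ(log n)`-clique `Q`, fewer than `|Q| - Ω(log n)` of `Q`'s pins in any
single clause of `Q`'s walk — pins must be dropped almost as fast as they are acquired (as PARKING does), everywhere.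
(The filter predicate quantifies over all times; it is read classically.)
-/

set_option linter.dupNamespace false

namespace Summit.PneNP.PneNP.Theorems.RamseyUncertifiableResolutionUncertainty

open Literature.Computability.Complexity Literature.Computability.MetaComplexity
open Summit.PneNP.PneNP.Theorems.RegularResolutionRung.Negative (cliqueCNF)

namespace TreeLike

section PinWidth

variable {n k : ℕ} (G : SimpleGraph (Fin n)) [DecidableRel G.Adj] {π : List (ResLine ℕ)} {r : ℕ}
  (hπ : IsResDerivation (cliqueCNF n k fun u v => decide (G.Adj u v)) π) (hr : r < π.length)
include hπ hr

/-- **Shown pins are vertices of `Q`**, at every time of the walk (no hypothesis on `π`). -/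
theorem shown_subset (hroot : (π[r]'hr).clause = ∅) (Q : Finset (Fin n)) (s : ℕ) :
    (((π[(run π (answer n k Q) r s).1]'(run_fst_lt _ hπ hr s)).clause.filter fun l => l.2 = false).image
        fun l => l.1 % n) ⊆ Q.image Fin.val := by
  classical
  intro x hx
  simp only [Finset.mem_image, Finset.mem_filter] at hx ⊢
  obtain ⟨l, ⟨hl, hl2⟩, rfl⟩ := hx
  have hf := run_falsifies (answer n k Q) hπ hr hroot s l hl
  rw [hl2] at hf
  obtain ⟨i, -, v, hv, hvQ⟩ := run_true_form (r := r) (π := π) Q _ hf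
  refine ⟨v, hvQ, ?_⟩
  rw [hv, Nat.add_mod, Nat.mul_mod_left, Nat.zero_add, Nat.mod_mod, Nat.mod_eq_of_lt v.isLt]

end PinWidth

end TreeLike

open scoped Classical in
/-- **Pin width counts.** For every graph `G`, every `k`, every resolution refutation `π` of the unary `Clique(G,k)`
(dag-like, no hypothesis) and all `t, p`: the number of `t`-cliques `Q` such that SOME line of Delayer `Q`'s walk carries
a clause showing at least `p` of `Q`'s pins (negative literals, read modulo `n`) is at most `|π| · Σ_{e ≤ t-p} C(n, e)`. -/
theorem card_filter_pinWidth_le :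
    ∀ {n k : ℕ} (G : SimpleGraph (Fin n)) [DecidableRel G.Adj] (π : List (ResLine ℕ))
      (hπ : IsResRefutation (cliqueCNF n k fun u v => decide (G.Adj u v)) π) (t p : ℕ),
      ∀ (r : ℕ) (hr : r < π.length), (π[r]'hr).clause = ∅ →
        ((G.cliqueFinset t).filter (fun Q => ∃ s : ℕ, p ≤
            (((π[(TreeLike.run π (TreeLike.answer n k Q) r s).1]'(TreeLike.run_fst_lt _ hπ.1 hr s)).clause.filter
              (fun l : Literal ℕ => l.2 = false)).image (fun l : Literal ℕ => l.1 % n)).card)).card ≤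
          π.length * (∑ e ∈ Finset.range (t - p + 1), n.choose e) := by
  intro n k G _ π hπ t p r hr hroot
  classical
  have hder := hπ.1
  -- shown pins at time `s`
  set X : Finset (Fin n) → ℕ → Finset ℕ := fun Q s =>
    (((π[(TreeLike.run π (TreeLike.answer n k Q) r s).1]'(TreeLike.run_fst_lt _ hder hr s)).clause.filter
      fun l => l.2 = false).image fun l => l.1 % n) with hX
  set good := (G.cliqueFinset t).filter fun Q => ∃ s : ℕ, p ≤ (X Q s).card with hgood
  -- a witness time for each good `Q` (junk `0` otherwise)
  let wit : Finset (Fin n) → ℕ := fun Q => if h : ∃ s : ℕ, p ≤ (X Q s).card then Nat.find h else 0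
  have hwit : ∀ Q ∈ good, p ≤ (X Q (wit Q)).card := by
    intro Q hQ
    obtain ⟨-, h⟩ := Finset.mem_filter.1 hQ
    simp only [wit, dif_pos h]
    exact Nat.find_spec h
  -- target: (line, subset of `range n` of size `≤ t - p`)
  set Tgt := (Finset.range π.length) ×ˢ
      ((Finset.range (t - p + 1)).biUnion fun e => (Finset.range n).powersetCard e) with hTgt
  have hTcard : Tgt.card ≤ π.length * (∑ e ∈ Finset.range (t - p + 1), n.choose e) := by
    rw [hTgt, Finset.card_product, Finset.card_range]
    refine Nat.mul_le_mul_left _ ?_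
    refine (Finset.card_biUnion_le).trans ?_
    refine Finset.sum_le_sum fun e _ => ?_
    rw [Finset.card_powersetCard, Finset.card_range]
  refine le_trans ?_ hTcard
  refine Finset.card_le_card_of_injOn
    (fun Q => ((TreeLike.run π (TreeLike.answer n k Q) r (wit Q)).1, Q.image Fin.val \ X Q (wit Q)))
    (fun Q hQ => ?_) ?_
  · rw [Finset.mem_coe] at hQ
    have hp := hwit Q hQ
    obtain ⟨hQcl, -⟩ := Finset.mem_filter.1 hQ
    have hQcard : Q.card = t := (SimpleGraph.mem_cliqueFinset_iff.1 hQcl).card_eq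
    have hsub : X Q (wit Q) ⊆ Q.image Fin.val := TreeLike.shown_subset G hder hr hroot Q (wit Q)
    rw [Finset.mem_coe, hTgt, Finset.mem_product]
    refine ⟨Finset.mem_range.2 (TreeLike.run_fst_lt _ hder hr _), ?_⟩
    rw [Finset.mem_biUnion]
    refine ⟨(Q.image Fin.val \ X Q (wit Q)).card, Finset.mem_range.2 ?_, ?_⟩
    · have h1 : (Q.image Fin.val \ X Q (wit Q)).card = (Q.image Fin.val).card - (X Q (wit Q)).card :=
        Finset.card_sdiff_of_subset hsub
      have h2 : (Q.image Fin.val).card = t := by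
        rw [Finset.card_image_of_injective _ Fin.val_injective, hQcard]
      have h3 : (X Q (wit Q)).card ≤ (Q.image Fin.val).card := Finset.card_le_card hsub
      omega
    · rw [Finset.mem_powersetCard]
      refine ⟨fun x hx => ?_, rfl⟩
      obtain ⟨hx, -⟩ := Finset.mem_sdiff.1 hx
      obtain ⟨v, -, rfl⟩ := Finset.mem_image.1 hx
      exact Finset.mem_range.2 v.isLt
  · intro Q hQ Q' hQ' heq
    obtain ⟨hline, hdiff⟩ := Prod.mk.injEq _ _ _ _ |>.mp heq
    have hsub : X Q (wit Q) ⊆ Q.image Fin.val := TreeLike.shown_subset G hder hr hroot Q (wit Q)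
    have hsub' : X Q' (wit Q') ⊆ Q'.image Fin.val := TreeLike.shown_subset G hder hr hroot Q' (wit Q')
    have key : ∀ {a b : ℕ} (ha : a < π.length) (hb : b < π.length), a = b →
        ((π[a]'ha).clause.filter (fun l => l.2 = false)).image (fun l => l.1 % n) =
        ((π[b]'hb).clause.filter (fun l => l.2 = false)).image (fun l => l.1 % n) := by
      intro a b ha hb hab; subst hab; rfl
    have hXX : X Q (wit Q) = X Q' (wit Q') := key _ _ hline
    have h1 : Q.image Fin.val = X Q (wit Q) ∪ (Q.image Fin.val \ X Q (wit Q)) :=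
      (Finset.union_sdiff_of_subset hsub).symm
    have h2 : Q'.image Fin.val = X Q' (wit Q') ∪ (Q'.image Fin.val \ X Q' (wit Q')) :=
      (Finset.union_sdiff_of_subset hsub').symm
    have : Q.image Fin.val = Q'.image Fin.val := by
      rw [h1, h2]
      rw [hXX] at hdiff ⊢
      rw [hdiff]
    exact Finset.image_injective Fin.val_injective this

end Summit.PneNP.PneNP.Theorems.RamseyUncertifiableResolutionUncertainty
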